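import Summits.QuantumFields.BalabanUV.T4Continuum.Support.NE9SpeciesFrameOfRecord
import Summits.QuantumFields.BalabanUV.T4Continuum.Support.NE9Lemma1CurveSpecies
import Summits.QuantumFields.BalabanUV.T4Continuum.Support.NE9Lemma1KernelSpecies

/-!
# NE9SpeciesDataOfRecord — THE TWO SPECIES DATA ON THE FRAME OF RECORD (O-NE9-1 item (ii), the NE9 owner's part, second half):
# `curDataOfRecord` (species (a), [I] Lemma 4 ∕ [II] (1.23)) and `kerDataOfRecord` (species (b), [I] (4.20)–(4.30)) as the tree's
# `CurData` ∕ `KerData` with the index frame FIXED to `NE9SpeciesFrameOfRecord` (boxes, families `Y₀`, sources, counting cubes,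
# fibres, the cube lists `Δ ⊂ Y₀ ∖ □̃⁴`, `dY = 1 + d_k(Y)`) and the ANALYTIC fields (slice curves `cur`, radii `ϱ ∕ R ∕ r`, `κ₁`;
# points `pts ∕ p0 ∕ dX ∕ ρd ∕ m` and the bilocal summand `ker`) left as the species' PARAMETERS; the frame binders of the END of
# record — level counts `hLa ∕ hLb`, source discipline `srcScale`, size-vs-volume `G1`, the cross-species identities `hκ₁ ∕ hR ∕ hdY`
# — DISCHARGED for these data (cell `pub-balaban`, T4-DAG §2 node U3 ∕ §6 NE9; BINDER row NE9 OWNER lineage `b2b-balaban-t4-ne9-p1`,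
# generation 36; CARVER-NOTES g34 §3; nothing of any import modified)

HONEST FRAMING (T4-DAG PAGE 1).  Rung (B)+1 of the FINITE-VOLUME T⁴ programme — NOT infinite volume, NOT a mass gap, NOT the
Clay problem.  NE9 (`T4OutputRate.NE9` ∧ `FadingMemory`) is a cell NEW ESTIMATE, NOT PRINTED in [I] = [Balaban1987RG1]
(CMP **109**), [II] = [Balaban1988RG2Cluster] (CMP **116**), and NOT PROVED for Bałaban's E^{(j)} («NE9 ⇐ the named binders»;
spine PROVED 0∕9).  HONEST DEPENDENCY (cell line, verbatim): continuum YM on T⁴ ⇐ BetaPertH ∧ nine spine estimates (0/9 proved);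
BetaPertH ⇐ (D1) ∧ (D4) ∧ CAP+tail; G-an2-4 gates asym, D1 and NE2/3/4.  `FlowStep.BetaPertH`, (B), (B^μ) do not occur.
DATA + bookkeeping; the analytic content of the species ([I] Lemma 4 (3.53) p. 280 = `CurData.Admissible.cur_an`; (4.21)–(4.22)
pp. 285–286 = `KerData.Admissible.kerBound`; the points' geometry (G)∕(S)) is NOT touched and stays DISPLAYED wherever the END
displays it (ABSOLUTE RULE: nothing printed in the audited series is asserted); 0 sorry.

WHAT.  The END of record read at the real row (`NE9EndAppliedRealRow.termSize_ne9_and_fadingMemory_realRow`, p225379) quantifies over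
species data families `D U : CurData C₀ E ι α β γ δ`, `K U : KerData C₀ E ι α' β' γ' δ' Pt` and displays, among its binders, the
FRAME-ONLY ones: `hLa ∕ hLb` (level counts of `(D U).toC.frame` ∕ `(K U).toC.frame`), `hκ₁ ∕ hR ∕ hdY` (the two species share `κ₁`,
the radii and the output sizes) and — inside `hD ∕ hK` — `srcScale` and `G1`.  With the index frame of record (`NE9SpeciesFrameOfRecord`,
generation 36, first half) these are decidable by construction.  THIS FILE:
* §1 `cubesList k □ Y₀` — the cubes `Δ ⊂ Y₀ ∖ □̃⁴` as a list of sigma cubes ([II] (1.10) p. 4 «Π_{Δ ⊂ Y₀∖□̃⁴}»), `length_cubesList`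
  (`= vol`, the paid volume);
* §2 **`curDataOfRecord R Yout κ₁ r Rad cur ϱ`** and **`kerDataOfRecord R Yout κ₁ r Rad pts p0 dX ρd m ker`** — the tree's species
  structures ON THE FRAME OF RECORD (`α = γ = δ = SCube R`, `β = Finset (SCube R)`; the table-coordinate type `ι` and the output
  reading `Yout` stay the instancer's);
* §3 the frame binders DISCHARGED in the END's binder shapes: **`levelCountsG_curDataOfRecord`** (`hLa`, letters κ ≥ 144, κ₁ ≥ 69,
  0 ≤ θ, L⁴θ⁵ ≤ ω, 625 ≤ c_Q), **`levelCountsG_kerDataOfRecord`** (`hLb`, general gain with the three letter binders of «LC-RECORD-FIVE»,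
  at any rate ≥ 144 — the END reads it at `κ − w`), `srcScale_curDataOfRecord ∕ _kerDataOfRecord`, **`G1_curDataOfRecord ∕
  _kerDataOfRecord`** (`dY ≤ 21203 + 4·#cubes`), and the cross-species identities `kappa1_eq ∕ radius_eq ∕ frame_dY_eq` (`rfl`).
WHAT THIS DOES NOT DO.  It does not construct `cur` (needs the complex background family of D-8 (v), `SubstrateComplexBackground(Lev)`,
an INTERFACE today, and the (1.1)∕(3.34) field `B(t,s,σ)` on `𝐇_k`) nor `ker` (the (4.20)–(4.30) bilocal summand), nor choose `pts`
(the unit-lattice points of `□̃⁴`: crew `NE9KernelGeometry*` supplies (G)∕(S) for the torus points of record); `cur_an`, `kerBound`,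
`geom ∕ sum0 ∕ sum1`, `ϱ_gt ∕ ϱ_inv_le`, `r_pos ∕ R_pos ∕ κ₁_ge` remain the `Admissible` hypotheses of the END, displayed.
DISGUISE TEST: two structure instances + `rfl`-level corollaries of generation 36's frame theorem; no inequality of the series.

References (TYPES ∕ loci only): [Balaban1988RG2Cluster] T. Bałaban, CMP **116** (1988) 1–22, (1.10) p. 4, (1.23)–(1.28) pp. 7–8,
(1.33) p. 9; [Balaban1987RG1] T. Bałaban, CMP **109** (1987) 249–301, Lemma 4 (3.53)–(3.54) p. 280, (4.20)–(4.30) pp. 285–288.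
Summits-side NEW work (LEAN PLACEMENT RULE); imports `NE9SpeciesFrameOfRecord` (generation 36), `NE9Lemma1CurveSpecies` (p214829),
`NE9Lemma1KernelSpecies` (p214555) BY NAME; modifies nothing.  Value = O-NE9-1 item (ii) reduced to its analytic fields: every
frame binder of the END is kernel for the data of record — bookkeeping on the row's instantiation path, NOT summit progress.
-/

noncomputable section

open scoped BigOperators

namespace Summit.QuantumFields.BalabanUV.T4Continuum.NE9SpeciesDataOfRecord

open Literature.MathematicalPhysics.QuantumFieldTheory.Balaban1983to89
open Literature.MathematicalPhysics.QuantumFieldTheory.Balaban1983to89.T4OutputRate (Carriers)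
open Literature.MathematicalPhysics.QuantumFieldTheory.Balaban1983to89.TreeLengthTorus (TPt TDom)
open Summit.QuantumFields.BalabanUV.T4Continuum.B13Carriers (TwoRuns)
open Summit.QuantumFields.BalabanUV.T4Continuum.B13DomainGeometryTR
open Summit.QuantumFields.BalabanUV.T4Continuum.NE9ComplexEncoding (doubleCarriers)
open Summit.QuantumFields.BalabanUV.T4Continuum.NE9Lemma1Counting
open Summit.QuantumFields.BalabanUV.T4Continuum.NE9Lemma1Gain
open Summit.QuantumFields.BalabanUV.T4Continuum.NE9Lemma1CurveSpecies
open Summit.QuantumFields.BalabanUV.T4Continuum.NE9Lemma1KernelSpecies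
open Summit.QuantumFields.BalabanUV.T4Continuum.NE9LevelCountsRecord (multiplicity_fst_le_two)
open Summit.QuantumFields.BalabanUV.T4Continuum.NE9LevelCountsRecordFive (levelCountsG_of_record₅)
open Summit.QuantumFields.BalabanUV.T4Continuum.NE9SpeciesFrameOfRecord

variable {G : Type} [GaugeGroup G] (R : TwoRuns G)

/-! ## §1 The cube lists `Δ ⊂ Y₀ ∖ □̃⁴` -/

/-- [folklore] DATA: the cubes `Δ ⊂ Y₀ ∖ □̃⁴` of a family, as a list of sigma cubes (the product `Π_{Δ ⊂ Y₀∖□̃⁴} ∫ ds(Δ) …` of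
[Balaban1988RG2Cluster] (1.10) p. 4 ∕ (1.23) p. 7 is indexed by it). -/
def cubesList (k : ℕ) (a : SCube R) (b : Finset (SCube R)) : List (SCube R) :=
  ((cubesOf R k b \ anchor R k a).map (embed R k)).toList

/-- [folklore] The cube list has the paid volume as its length: `#cubesList = vol = #(Y₀ ∖ □̃⁴)`. -/
theorem length_cubesList (k : ℕ) (a : SCube R) (b : Finset (SCube R)) : ((cubesList R k a b).length : ℝ) = vol R k a b := by
  unfold cubesList vol
  rw [Finset.length_toList, Finset.card_map]

/-! ## §2 The general-gain level counts of the frame of record -/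

/-- **THE LEVEL COUNTS OF THE FRAME OF RECORD WITH A GENERAL GAIN** (the kernel species' `hLb` reads a general `gain` at rate
`κ − w`): as `NE9SpeciesFrameOfRecord.levelCountsG_of_frameOfRecord`, with «LC-RECORD-FIVE»'s three letter binders
(`hgain ∕ hcQℓ ∕ hletters`, the window count `w = 625`) in place of the `agePow` letters; every identification reading discharged by
construction. [cite: Balaban1988RG2Cluster, (1.26)-(1.28) p.8] -/
theorem levelCountsG_of_frameOfRecord_gain {Bg ι : Type}
    (P : PieceData (doubleCarriers R.carriers) Bg ι (SCube R) (Finset (SCube R)) (SCube R)) (Yout : ℕ → ι → R.carriers.Dom)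
    (hS0 : ∀ k y, P.S0 k y = boxes R k (Yout k y)) (hSY : ∀ k y a, P.SY k y a = families R k (Yout k y) a)
    (hsrc : ∀ k y a j, P.src k y a j = sources R k a j) (hSq : ∀ k y a j, P.Sq k y a j = countingCubes R k a j)
    (hSX : ∀ k y a j q, P.SX k y a j q = fibre R k a j q)
    (hvol : ∀ k y a, ∀ b ∈ P.SY k y a, P.vol k y a b = vol R k a b)
    (hdY : ∀ k y, 1 + R.carriers.d (Yout k y) ≤ P.dY k y)
    {κ κ₁ cQ : ℝ} {gain ℓ' : ℕ → ℕ → ℝ} (hκ : 144 ≤ κ) (hκ₁ : 69 ≤ κ₁) (hgain : ∀ k j, 0 ≤ gain k j)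
    (hcQℓ : ∀ k j, 0 ≤ cQ * ℓ' k j) (hletters : ∀ k j, j ≤ k → 625 * ((R.F.L : ℝ) ^ 4) ^ (k - j) * gain k j ≤ cQ * ℓ' k j) :
    LevelCountsG P κ κ₁ (2 * (2 ^ 20 + 1)) cQ gain ℓ' := by
  have h := levelCountsG_of_record₅ R P (m := 2) Prod.fst (fun _ => rfl)
    (fun k y a j q Y => by rw [hSX]; exact multiplicity_fst_le_two _ Y)
    (fun k _ a j q => cubeAt R j q)
    (fun k y a j q x hx => by rw [hSX] at hx; exact fibre_reads k a j q x hx)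
    hκ Yout (fun k y => by rw [hS0]; exact card_boxes_le k (Yout k y)) hdY hκ₁
    (fun k _ a => anchor R k a) (fun k _ _ b => cubesOf R k b)
    (fun k y a => by rw [hSY]; exact injOn_cubesOf_families k (Yout k y) a)
    (fun k y a b hb => by
      rw [hSY] at hb
      obtain ⟨hA, hne, hC, -⟩ := cubesOf_of_mem_families hb
      exact ⟨hA, hne, hC⟩)
    (fun k _ a => anchor_nonempty_card_le k a)
    (fun k y a b hb => hvol k y a b hb)
    (fun k _ a => window R k a) (w := 625) (fun k _ a => card_window_le k a)
    (fun k y a j => by rw [hSq]; exact injOn_cubeAt_countingCubes k a j)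
    (fun k y a j q hq => by rw [hSq] at hq; exact countingCubes_reads k a j q hq)
    (fun k y a j x hx => by rw [hsrc] at hx; exact sources_read k a j x hx)
    (fun k y a j hjk hk b hb => by rw [hSq]; exact countingCubes_surj k a j hjk hk b hb)
    (fun k y a j q hq x hx hfp => by rw [hSX]; rw [hsrc] at hx; exact mem_fibre_of_mem_sources k a j hx hfp)
    hgain hcQℓ hletters
  simpa using h

/-! ## §3 The curve species (a) on the frame of record -/

section Cur

variable {E ι : Type}

/-- [folklore] DATA: **THE CURVE-SPECIES DATUM ON THE FRAME OF RECORD** — the tree's `CurData` ([I] Lemma 4 ∕ [II] (1.23)) with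
`S0 ∕ SY ∕ src ∕ Sq ∕ SX ∕ dY ∕ cubes` := the frame of record read at `Yout`, and the ANALYTIC fields — `κ₁`, the t_□-radii `r`, the
analyticity radii `Rad` (R_X), the slice curves `cur` (σ′ ↦ U_j(□₀, exp iσ′B)∣_X on the chart) and the slice radii `ϱ` — as the
species' parameters. [cite: Balaban1987RG1, Lemma 4 (3.53) p.280; Balaban1988RG2Cluster, (1.23) p.7] -/
def curDataOfRecord (Yout : ℕ → ι → R.carriers.Dom) (κ₁ : ℝ) (r : ℕ → ℝ) (Rad : R.carriers.Dom → ℝ)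
    (cur : ℕ → (ℕ → ℝ) → ι → SCube R → Finset (SCube R) → (doubleCarriers R.carriers).Dom → ℂ → (SCube R → ℝ) →
      (SCube R → ℂ) → ℂ → E)
    (ϱ : ℕ → (ℕ → ℝ) → ι → SCube R → Finset (SCube R) → (doubleCarriers R.carriers).Dom → ℝ) :
    CurData R.carriers E ι (SCube R) (Finset (SCube R)) (SCube R) (SCube R) where
  S0 := fun k y => boxes R k (Yout k y)
  SY := fun k y a => families R k (Yout k y) a
  src := fun k _ a j => sources R k a j
  Sq := fun k _ a j => countingCubes R k a j
  SX := fun k _ a j q => fibre R k a j q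
  dY := fun k y => 1 + R.carriers.d (Yout k y)
  κ₁ := κ₁
  r := r
  cubes := fun k _ a b => cubesList R k a b
  cur := cur
  R := Rad
  ϱ := ϱ

variable (Yout : ℕ → ι → R.carriers.Dom) (κ₁ : ℝ) (r : ℕ → ℝ) (Rad : R.carriers.Dom → ℝ)
  (cur : ℕ → (ℕ → ℝ) → ι → SCube R → Finset (SCube R) → (doubleCarriers R.carriers).Dom → ℂ → (SCube R → ℝ) →
    (SCube R → ℂ) → ℂ → E)
  (ϱ : ℕ → (ℕ → ℝ) → ι → SCube R → Finset (SCube R) → (doubleCarriers R.carriers).Dom → ℝ)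

/-- **`hLa` FOR THE CURVE SPECIES OF RECORD** — the level counts of its frame, letters only.
[cite: Balaban1988RG2Cluster, (1.26)-(1.28) p.8] -/
theorem levelCountsG_curDataOfRecord {κ cQ θ ω : ℝ} (hκ : 144 ≤ κ) (hκ₁ : 69 ≤ κ₁) (hθ : 0 ≤ θ)
    (hper : (R.F.L : ℝ) ^ 4 * θ ^ 5 ≤ ω) (hw : (625 : ℝ) ≤ cQ) :
    LevelCountsG (curDataOfRecord R Yout κ₁ r Rad cur ϱ).toC.frame κ κ₁ (2 * (2 ^ 20 + 1)) cQ
      (fun k j => agePow θ k j ^ 5) (agePow ω) :=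
  levelCountsG_of_frameOfRecord R _ Yout (fun _ _ => rfl) (fun _ _ _ => rfl) (fun _ _ _ _ => rfl) (fun _ _ _ _ => rfl)
    (fun _ _ _ _ _ => rfl) (fun k _ a b _ => length_cubesList R k a b) (fun _ _ => le_rfl) hκ hκ₁ hθ hper hw

/-- **`srcScale` FOR THE CURVE SPECIES OF RECORD** (the `Admissible.srcScale` binder): sources have the creation step of their slot.
[folklore] -/
theorem srcScale_curDataOfRecord :
    ∀ k y a j, ∀ x ∈ (curDataOfRecord R Yout κ₁ r Rad cur ϱ).src k y a j, R.carriers.scale x.1 = j :=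
  fun _ _ _ _ _ hx => scale_of_mem_sources hx

/-- **`G1` FOR THE CURVE SPECIES OF RECORD** (the `Admissible.G1` binder with `d₀ = 21203`): `dY ≤ 21203 + 4·#cubes`.
[cite: Balaban1988RG2Cluster, (1.25) p.7] -/
theorem G1_curDataOfRecord : ∀ k y, ∀ a ∈ (curDataOfRecord R Yout κ₁ r Rad cur ϱ).S0 k y,
    ∀ b ∈ (curDataOfRecord R Yout κ₁ r Rad cur ϱ).SY k y a,
      (curDataOfRecord R Yout κ₁ r Rad cur ϱ).dY k y ≤
        21203 + 4 * (((curDataOfRecord R Yout κ₁ r Rad cur ϱ).cubes k y a b).length : ℝ) := by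
  intro k y a ha b hb
  show 1 + R.carriers.d (Yout k y) ≤ 21203 + 4 * ((cubesList R k a b).length : ℝ)
  rw [length_cubesList]
  exact one_add_d_le_vol ha hb

end Cur

/-! ## §4 The kernel species (b) on the frame of record -/

section Ker

variable {E ι Pt : Type}

/-- [folklore] DATA: **THE KERNEL-SPECIES DATUM ON THE FRAME OF RECORD** — the tree's `KerData` ([I] (4.20)–(4.30)) with the frame
fields := the frame of record read at `Yout` and the ANALYTIC ∕ GEOMETRIC fields — `κ₁`, `r`, `Rad`, the points `pts` of `□̃⁴`, the base
point `p0`, the distances `dX ∕ ρd`, the power `m` and the bilocal summand `ker` — as the species' parameters.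
[cite: Balaban1987RG1, (4.20)-(4.22) pp.285-286] -/
def kerDataOfRecord (Yout : ℕ → ι → R.carriers.Dom) (κ₁ : ℝ) (r : ℕ → ℝ) (Rad : R.carriers.Dom → ℝ)
    (pts : ℕ → ι → SCube R → Finset Pt) (p0 : R.carriers.Dom → Pt) (dX : R.carriers.Dom → Pt → ℝ) (ρd : Pt → Pt → ℝ) (m : ℕ)
    (ker : ℕ → (ℕ → ℝ) → ι → SCube R → Finset (SCube R) → (doubleCarriers R.carriers).Dom → ℂ → (SCube R → ℝ) →
      (SCube R → ℂ) → Pt → Pt → (E → ℂ) → ℂ) :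
    KerData R.carriers E ι (SCube R) (Finset (SCube R)) (SCube R) (SCube R) Pt where
  S0 := fun k y => boxes R k (Yout k y)
  SY := fun k y a => families R k (Yout k y) a
  src := fun k _ a j => sources R k a j
  Sq := fun k _ a j => countingCubes R k a j
  SX := fun k _ a j q => fibre R k a j q
  dY := fun k y => 1 + R.carriers.d (Yout k y)
  κ₁ := κ₁
  r := r
  cubes := fun k _ a b => cubesList R k a b
  R := Rad
  pts := pts
  p0 := p0
  dX := dX
  ρd := ρd
  m := m
  ker := ker

variable (Yout : ℕ → ι → R.carriers.Dom) (κ₁ : ℝ) (r : ℕ → ℝ) (Rad : R.carriers.Dom → ℝ)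
  (pts : ℕ → ι → SCube R → Finset Pt) (p0 : R.carriers.Dom → Pt) (dX : R.carriers.Dom → Pt → ℝ) (ρd : Pt → Pt → ℝ) (m : ℕ)
  (ker : ℕ → (ℕ → ℝ) → ι → SCube R → Finset (SCube R) → (doubleCarriers R.carriers).Dom → ℂ → (SCube R → ℝ) →
    (SCube R → ℂ) → Pt → Pt → (E → ℂ) → ℂ)

/-- **`hLb` FOR THE KERNEL SPECIES OF RECORD** — the level counts of its frame with a general gain at any rate `κ' ≥ 144` (the END
reads `κ' = κ − w`), letters only. [cite: Balaban1988RG2Cluster, (1.26)-(1.28) p.8] -/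
theorem levelCountsG_kerDataOfRecord {κ' cQ : ℝ} {gain ℓ' : ℕ → ℕ → ℝ} (hκ : 144 ≤ κ') (hκ₁ : 69 ≤ κ₁)
    (hgain : ∀ k j, 0 ≤ gain k j) (hcQℓ : ∀ k j, 0 ≤ cQ * ℓ' k j)
    (hletters : ∀ k j, j ≤ k → 625 * ((R.F.L : ℝ) ^ 4) ^ (k - j) * gain k j ≤ cQ * ℓ' k j) :
    LevelCountsG (kerDataOfRecord R Yout κ₁ r Rad pts p0 dX ρd m ker).toC.frame κ' κ₁ (2 * (2 ^ 20 + 1)) cQ gain ℓ' :=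
  levelCountsG_of_frameOfRecord_gain R _ Yout (fun _ _ => rfl) (fun _ _ _ => rfl) (fun _ _ _ _ => rfl) (fun _ _ _ _ => rfl)
    (fun _ _ _ _ _ => rfl) (fun k _ a b _ => length_cubesList R k a b) (fun _ _ => le_rfl) hκ hκ₁ hgain hcQℓ hletters

/-- **`srcScale` FOR THE KERNEL SPECIES OF RECORD**. [folklore] -/
theorem srcScale_kerDataOfRecord :
    ∀ k y a j, ∀ x ∈ (kerDataOfRecord R Yout κ₁ r Rad pts p0 dX ρd m ker).src k y a j, R.carriers.scale x.1 = j :=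
  fun _ _ _ _ _ hx => scale_of_mem_sources hx

/-- **`G1` FOR THE KERNEL SPECIES OF RECORD** (`d₀ = 21203`). [cite: Balaban1988RG2Cluster, (1.25) p.7] -/
theorem G1_kerDataOfRecord : ∀ k y, ∀ a ∈ (kerDataOfRecord R Yout κ₁ r Rad pts p0 dX ρd m ker).S0 k y,
    ∀ b ∈ (kerDataOfRecord R Yout κ₁ r Rad pts p0 dX ρd m ker).SY k y a,
      (kerDataOfRecord R Yout κ₁ r Rad pts p0 dX ρd m ker).dY k y ≤
        21203 + 4 * (((kerDataOfRecord R Yout κ₁ r Rad pts p0 dX ρd m ker).cubes k y a b).length : ℝ) := by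
  intro k y a ha b hb
  show 1 + R.carriers.d (Yout k y) ≤ 21203 + 4 * ((cubesList R k a b).length : ℝ)
  rw [length_cubesList]
  exact one_add_d_le_vol ha hb

/-! ## §5 The cross-species identities of the END (`hκ₁ ∕ hR ∕ hdY`), by `rfl` -/

variable (cur : ℕ → (ℕ → ℝ) → ι → SCube R → Finset (SCube R) → (doubleCarriers R.carriers).Dom → ℂ → (SCube R → ℝ) →
    (SCube R → ℂ) → ℂ → E)
  (ϱ : ℕ → (ℕ → ℝ) → ι → SCube R → Finset (SCube R) → (doubleCarriers R.carriers).Dom → ℝ)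

/-- [folklore] The two species of record share `κ₁` (the END's `hκ₁`). -/
theorem kappa1_eq : (kerDataOfRecord R Yout κ₁ r Rad pts p0 dX ρd m ker).κ₁ = (curDataOfRecord R Yout κ₁ r Rad cur ϱ).κ₁ := rfl

/-- [folklore] The two species of record share the analyticity radii (the END's `hR`). -/
theorem radius_eq : (kerDataOfRecord R Yout κ₁ r Rad pts p0 dX ρd m ker).R = (curDataOfRecord R Yout κ₁ r Rad cur ϱ).R := rfl

/-- [folklore] The two species of record share the output sizes (the END's `hdY`). -/
theorem frame_dY_eq : (kerDataOfRecord R Yout κ₁ r Rad pts p0 dX ρd m ker).toC.frame.dY =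
    (curDataOfRecord R Yout κ₁ r Rad cur ϱ).toC.frame.dY := rfl

end Ker

end Summit.QuantumFields.BalabanUV.T4Continuum.NE9SpeciesDataOfRecord

end
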